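import Mathlib
import Literature.Probability.LatticeModels.GKSInequalities
import Summits.CriticalPhenomena.Ising3DConformalLimit.Theorems.PrecisionLaplacianInverseMFerromagnetImOfImDeg3
import Summits.CriticalPhenomena.Ising3DConformalLimit.Theorems.PrecisionLaplacianInverseMFerromagnetLevelLeOne
import HarnessLib

/-!
# Crux `PrecisionLaplacian.InverseMFerromagnet` (stmt-CriticalPhenomena-4798), line `Sketch` —
# stub `helper_sp_pendant` (T-SP·1: the dressed edge bound survives appending a pendant site)

THEOREM-ONLY file (no definitions).  DB♯ for the spin second-moment matrix `Σ = (⟨σ_pσ_q⟩)` of a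
zero-field pair ferromagnet says `(Σ⁻¹)_xy ≤ −t/(1 + t² − 2tG_xy)` (`x ≠ y`,
`t = tanh ∑_{i : C i = {x,y}} K_i`, `G_xy = ⟨σ_xσ_y⟩`).  If the structure `(n, m, C)` satisfies DB♯
for ALL couplings `≥ 0`, so does the structure with the old bonds embedded along `Fin.castSucc`
and the pendant bond `Fin.last m = {v', L}` (`v' = v.castSucc`, `L = Fin.last n`).
Proof.  Put `k = K' ∘ castSucc`, `a = K' (last m)`, `t = tanh a`, `Σ` = old matrix at `k`.
MARGINAL: a configuration on `Fin (n+1)` is `Fin.snoc σ u` with weight `w_k(σ) e^{aσ_v u}`, and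
`∑_u e^{aσ_v u} = 2cosh a`, `∑_u u e^{aσ_v u} = 2σ_v sinh a`, so `Σ'(p',q') = Σ(p,q)`,
`Σ'(L,q') = tΣ(v,q)`, `Σ'(L,L) = 1`.  PRECISION (`spPend_inv_entries`): the bordered matrix has the
explicit inverse `M(p',q') = Σ⁻¹(p,q) + [p=q=v]t²/(1−t²)`, `M(p',L) = M(L,p') = −[p=v]t/(1−t²)`,
`M(L,L) = 1/(1−t²)` (`MΣ' = 1`).  Old pairs: same entry, same total coupling, same `G`, so the
hypothesis at `k` applies; `(v',L)`: `−t/(1−t²)` IS the bound (`G' = t`); `(p',L)`, `p ≠ v`: `0 ≤ 0`.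
-/

namespace Summit.CriticalPhenomena.Ising3DConformalLimit.Cruxes.InverseMFerromagnet.PartialCovarianceLadder

open Literature.Probability.LatticeModels Finset Matrix

/-! ## Sums over the pendant spin -/

/-- `∑_{u = ±1} e^{a s u} = 2 cosh a` for a spin value `s = ±1`. [folklore] -/
theorem spPend_sum_exp (a s : ℝ) (hs : s = 1 ∨ s = -1) :
    ∑ u : ℤˣ, Real.exp (a * (s * ((u : ℤ) : ℝ))) = 2 * Real.cosh a := by
  rw [UnitsInt.univ, Finset.sum_pair (by decide : (1 : ℤˣ) ≠ -1), Real.cosh_eq]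
  rcases hs with rfl | rfl <;>
    simp only [Units.val_one, Units.val_neg, Int.cast_one, Int.cast_neg, mul_one, mul_neg_one,
      neg_neg] <;> ring

/-- `∑_{u = ±1} u e^{a s u} = 2 s sinh a` for a spin value `s = ±1`. [folklore] -/
theorem spPend_sum_mul_exp (a s : ℝ) (hs : s = 1 ∨ s = -1) :
    ∑ u : ℤˣ, ((u : ℤ) : ℝ) * Real.exp (a * (s * ((u : ℤ) : ℝ))) = 2 * Real.sinh a * s := by
  rw [UnitsInt.univ, Finset.sum_pair (by decide : (1 : ℤˣ) ≠ -1), Real.sinh_eq]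
  rcases hs with rfl | rfl <;>
    simp only [Units.val_one, Units.val_neg, Int.cast_one, Int.cast_neg, mul_one, mul_neg_one,
      neg_neg, one_mul, neg_mul] <;> ring

/-- Summing over the configurations on `Fin (n+1)` is summing over (old configuration, pendant
spin) along `Fin.snoc`. [folklore] -/
theorem spPend_sum_snoc {n : ℕ} (g : SpinConfig (Fin (n + 1)) → ℝ) :
    ∑ ω, g ω = ∑ σ : SpinConfig (Fin n), ∑ u : ℤˣ, g (Fin.snoc σ u) := by
  have h1 : ∑ pr : ℤˣ × SpinConfig (Fin n), g (Fin.snoc pr.2 pr.1) = ∑ ω, g ω :=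
    Fintype.sum_equiv (Fin.snocEquiv fun _ => ℤˣ) _ _ (fun _ => rfl)
  rw [← h1, Fintype.sum_prod_type, Finset.sum_comm]

/-- `{p, q}` embedded along `castSucc`. [folklore] -/
theorem spPend_map_pair {n : ℕ} (p q : Fin n) :
    ({p, q} : Finset (Fin n)).map Fin.castSuccEmb = {p.castSucc, q.castSucc} := by
  simp [Finset.map_insert]

/-- The last site is not in the image of `castSucc`. [folklore] -/
theorem spPend_last_not_mem_map {n : ℕ} (s : Finset (Fin n)) :
    Fin.last n ∉ s.map Fin.castSuccEmb := by
  simp [Finset.mem_map]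

/-! ## Linear algebra: the inverse of the bordered matrix -/

/-- **The precision matrix of a pendant extension.** Let `S` be positive definite with
`S v v = 1`, `1 − t² ≠ 0`, and let `S'` on `Fin (n+1)` have old block `S`, last row/column
`t S(v, ·)` and corner `1`.  Then `S'⁻¹(p', q') = S⁻¹(p, q) + [p = q = v] t²/(1−t²)`,
`S'⁻¹(p', L) = S'⁻¹(L, p') = −[p = v] t/(1−t²)` (the candidate is a left inverse). [folklore] -/
theorem spPend_inv_entries {n : ℕ} (S : Matrix (Fin n) (Fin n) ℝ) (hS : S.PosDef) (v : Fin n)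
    (hvv : S v v = 1) (t : ℝ) (ht : 1 - t ^ 2 ≠ 0) (S' : Matrix (Fin (n + 1)) (Fin (n + 1)) ℝ)
    (hcc : ∀ p q : Fin n, S' p.castSucc q.castSucc = S p q)
    (hLc : ∀ q : Fin n, S' (Fin.last n) q.castSucc = t * S v q)
    (hcL : ∀ p : Fin n, S' p.castSucc (Fin.last n) = t * S p v)
    (hLL : S' (Fin.last n) (Fin.last n) = 1) :
    (∀ p q : Fin n, S'⁻¹ p.castSucc q.castSucc
        = S⁻¹ p q + if p = v ∧ q = v then t ^ 2 / (1 - t ^ 2) else 0) ∧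
      (∀ p : Fin n, S'⁻¹ p.castSucc (Fin.last n) = if p = v then -t / (1 - t ^ 2) else 0) ∧
      (∀ q : Fin n, S'⁻¹ (Fin.last n) q.castSucc = if q = v then -t / (1 - t ^ 2) else 0) := by
  have hPS : S⁻¹ * S = 1 :=
    Matrix.nonsing_inv_mul S ((Matrix.isUnit_iff_isUnit_det S).mp hS.isUnit)
  have hrow : ∀ p q : Fin n, ∑ r, S⁻¹ p r * S r q = if p = q then 1 else 0 := fun p q => by
    have h := congrFun (congrFun hPS p) q
    rwa [Matrix.mul_apply, Matrix.one_apply] at h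
  obtain ⟨M, hM⟩ : ∃ M : Matrix (Fin (n + 1)) (Fin (n + 1)) ℝ, M = Matrix.of
      (Fin.snoc (α := fun _ => Fin (n + 1) → ℝ)
        (fun p : Fin n => Fin.snoc (α := fun _ => ℝ)
          (fun q : Fin n => S⁻¹ p q + if p = v ∧ q = v then t ^ 2 / (1 - t ^ 2) else 0)
          (if p = v then -t / (1 - t ^ 2) else 0))
        (Fin.snoc (α := fun _ => ℝ) (fun q : Fin n => if q = v then -t / (1 - t ^ 2) else 0)
          (1 / (1 - t ^ 2)))) := ⟨_, rfl⟩
  have hMcc : ∀ p q : Fin n, M p.castSucc q.castSucc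
      = S⁻¹ p q + if p = v ∧ q = v then t ^ 2 / (1 - t ^ 2) else 0 := fun p q => by
    simp only [hM, Matrix.of_apply, Fin.snoc_castSucc]
  have hMcL : ∀ p : Fin n, M p.castSucc (Fin.last n) = if p = v then -t / (1 - t ^ 2) else 0 :=
    fun p => by simp only [hM, Matrix.of_apply, Fin.snoc_castSucc, Fin.snoc_last]
  have hMLc : ∀ q : Fin n, M (Fin.last n) q.castSucc = if q = v then -t / (1 - t ^ 2) else 0 :=
    fun q => by simp only [hM, Matrix.of_apply, Fin.snoc_castSucc, Fin.snoc_last]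
  have hMLL : M (Fin.last n) (Fin.last n) = 1 / (1 - t ^ 2) := by
    simp only [hM, Matrix.of_apply, Fin.snoc_last]
  have hite : ∀ (p : Fin n) (c : ℝ) (f : Fin n → ℝ),
      ∑ r, (if p = v ∧ r = v then c else 0) * f r = if p = v then c * f v else 0 := by
    intro p c f
    by_cases hpv : p = v
    · simp [hpv, ite_mul, Finset.sum_ite_eq']
    · simp [hpv]
  have hite' : ∀ (c : ℝ) (f : Fin n → ℝ), ∑ r, (if r = v then c else 0) * f r = c * f v := by
    intro c f
    simp [ite_mul, Finset.sum_ite_eq']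
  have hMS : M * S' = 1 := by
    ext p q
    rw [Matrix.mul_apply, Fin.sum_univ_castSucc, Matrix.one_apply]
    obtain ⟨p, rfl⟩ | rfl := Fin.eq_castSucc_or_eq_last p <;>
      obtain ⟨q, rfl⟩ | rfl := Fin.eq_castSucc_or_eq_last q
    · -- old row, old column
      simp only [hMcc, hMcL, hcc, hLc, Fin.castSucc_inj, add_mul, Finset.sum_add_distrib, hrow,
        hite]
      by_cases hpv : p = v
      · subst hpv
        simp only [if_true]
        ring
      · simp [hpv]
    · -- old row, last column
      rw [if_neg (Fin.castSucc_lt_last p).ne]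
      have h1 : ∀ r : Fin n, M p.castSucc r.castSucc * S' r.castSucc (Fin.last n)
          = t * (S⁻¹ p r * S r v)
            + t * ((if p = v ∧ r = v then t ^ 2 / (1 - t ^ 2) else 0) * S r v) := by
        intro r
        rw [hMcc, hcL]
        ring
      simp only [h1, Finset.sum_add_distrib, ← Finset.mul_sum, hrow, hite, hMcL, hLL, hvv]
      by_cases hpv : p = v
      · subst hpv
        simp only [if_true]
        field_simp
        ring
      · simp [hpv]
    · -- last row, old column
      rw [if_neg (Fin.castSucc_lt_last q).ne']
      simp only [hMLc, hcc, hMLL, hLc, hite']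
      ring
    · -- the corner
      rw [if_pos rfl]
      simp only [hMLc, hcL, hMLL, hLL, hite', hvv]
      field_simp
      ring
  have hinv : S'⁻¹ = M := Matrix.inv_eq_left_inv hMS
  refine ⟨fun p q => ?_, fun p => ?_, fun q => ?_⟩
  · rw [hinv, hMcc]
  · rw [hinv, hMcL]
  · rw [hinv, hMLc]

/-! ## The pendant system: marginal on the old sites, total couplings on pairs -/

section Pendant

variable {n m : ℕ} (C : Fin m → Finset (Fin n)) (v : Fin n)
  (C' : Fin (m + 1) → Finset (Fin (n + 1)))
  (hC' : ∀ i : Fin m, C' i.castSucc = (C i).map Fin.castSuccEmb)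
  (hC'l : C' (Fin.last m) = {v.castSucc, Fin.last n}) (K' : Fin (m + 1) → ℝ) (k : Fin m → ℝ)
  (a : ℝ) (hk : ∀ i : Fin m, K' i.castSucc = k i) (ha : K' (Fin.last m) = a)

include hC' hC'l

include hk ha in
/-- The Boltzmann weight of the pendant system at `Fin.snoc σ u`: the old weight (couplings
`k = K' ∘ castSucc`) times the pendant bond factor `e^{a σ_v u}`. [folklore] -/
theorem spPend_gksWeight_snoc (σ : SpinConfig (Fin n)) (u : ℤˣ) :
    gksWeight Finset.univ K' C' (Fin.snoc σ u)
      = gksWeight Finset.univ k C σ * Real.exp (a * (spinAt v σ * ((u : ℤ) : ℝ))) := by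
  rw [gksWeight, gksWeight, ← Real.exp_add, gksHamiltonian, gksHamiltonian, Fin.sum_univ_castSucc]
  congr 1
  congr 1
  · refine Finset.sum_congr rfl fun i _ => ?_
    rw [hk, hC', spinProduct, spinProduct, Finset.prod_map]
    congr 1
    refine Finset.prod_congr rfl fun p _ => ?_
    simp only [spinAt, Fin.castSuccEmb_apply, Fin.snoc_castSucc]
  · rw [ha, hC'l, spinProduct, Finset.prod_pair (Fin.castSucc_lt_last v).ne]
    simp only [spinAt, Fin.snoc_castSucc, Fin.snoc_last]

include hk ha in
/-- **Summing out the pendant spin.** For an observable `F` of the old spins,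
`Z'⟨F⟩' = 2cosh(a) · Z⟨F⟩` (old system at the couplings `k = K' ∘ castSucc`). [folklore] -/
theorem spPend_gksSum (F : SpinConfig (Fin n) → ℝ) :
    gksSum Finset.univ K' C' (fun ω => F (fun p => ω p.castSucc))
      = 2 * Real.cosh a * gksSum Finset.univ k C F := by
  unfold gksSum
  rw [spPend_sum_snoc, Finset.mul_sum]
  refine Finset.sum_congr rfl fun σ _ => ?_
  have hterm : ∀ u : ℤˣ,
      F (fun p => (Fin.snoc σ u : SpinConfig (Fin (n + 1))) p.castSucc)
          * gksWeight Finset.univ K' C' (Fin.snoc σ u)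
        = F σ * gksWeight Finset.univ k C σ * Real.exp (a * (spinAt v σ * ((u : ℤ) : ℝ))) := by
    intro u
    rw [spPend_gksWeight_snoc C v C' hC' hC'l K' k a hk ha σ u, ← mul_assoc]
    simp only [Fin.snoc_castSucc]
  rw [Finset.sum_congr rfl (fun u _ => hterm u), ← Finset.mul_sum,
    spPend_sum_exp a (spinAt v σ) (spinAt_eq_one_or_eq_neg_one v σ)]
  ring

include hk ha in
/-- **Summing out the pendant spin against `σ_L`.** For an observable `F` of the old spins,
`Z'⟨σ_L F⟩' = 2sinh(a) · Z⟨σ_v F⟩`. [folklore] -/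
theorem spPend_gksSum_last (F : SpinConfig (Fin n) → ℝ) :
    gksSum Finset.univ K' C' (fun ω => spinAt (Fin.last n) ω * F (fun p => ω p.castSucc))
      = 2 * Real.sinh a * gksSum Finset.univ k C (fun σ => spinAt v σ * F σ) := by
  unfold gksSum
  rw [spPend_sum_snoc, Finset.mul_sum]
  refine Finset.sum_congr rfl fun σ _ => ?_
  have hterm : ∀ u : ℤˣ,
      spinAt (Fin.last n) (Fin.snoc σ u : SpinConfig (Fin (n + 1)))
          * F (fun p => (Fin.snoc σ u : SpinConfig (Fin (n + 1))) p.castSucc)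
          * gksWeight Finset.univ K' C' (Fin.snoc σ u)
        = F σ * gksWeight Finset.univ k C σ
          * (((u : ℤ) : ℝ) * Real.exp (a * (spinAt v σ * ((u : ℤ) : ℝ)))) := by
    intro u
    rw [spPend_gksWeight_snoc C v C' hC' hC'l K' k a hk ha σ u]
    simp only [spinAt, Fin.snoc_castSucc, Fin.snoc_last]
    ring
  rw [Finset.sum_congr rfl (fun u _ => hterm u), ← Finset.mul_sum,
    spPend_sum_mul_exp a (spinAt v σ) (spinAt_eq_one_or_eq_neg_one v σ)]
  ring

include hk ha in
/-- **Marginal identity.** The law of the old spins under the pendant system is the old system at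
the couplings `k = K' ∘ castSucc`: `⟨F⟩' = ⟨F⟩`. [folklore] -/
theorem spPend_gksExpect (F : SpinConfig (Fin n) → ℝ) :
    gksExpect Finset.univ K' C' (fun ω => F (fun p => ω p.castSucc))
      = gksExpect Finset.univ k C F := by
  have hc : (2 * Real.cosh a) ≠ 0 := (mul_pos two_pos (Real.cosh_pos a)).ne'
  have h1 : gksSum Finset.univ K' C' (fun _ => (1 : ℝ))
      = 2 * Real.cosh a * gksSum Finset.univ k C (fun _ => 1) :=
    spPend_gksSum C v C' hC' hC'l K' k a hk ha (fun _ => (1 : ℝ))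
  unfold gksExpect
  rw [spPend_gksSum C v C' hC' hC'l K' k a hk ha F, h1]
  exact mul_div_mul_left _ _ hc

include hk ha in
/-- **Correlations with the pendant spin.** `⟨σ_L F⟩' = tanh(a) ⟨σ_v F⟩` for an observable `F` of
the old spins. [folklore] -/
theorem spPend_gksExpect_last (F : SpinConfig (Fin n) → ℝ) :
    gksExpect Finset.univ K' C' (fun ω => spinAt (Fin.last n) ω * F (fun p => ω p.castSucc))
      = Real.tanh a * gksExpect Finset.univ k C (fun σ => spinAt v σ * F σ) := by
  have h1 : gksSum Finset.univ K' C' (fun _ => (1 : ℝ))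
      = 2 * Real.cosh a * gksSum Finset.univ k C (fun _ => 1) :=
    spPend_gksSum C v C' hC' hC'l K' k a hk ha (fun _ => (1 : ℝ))
  unfold gksExpect
  rw [spPend_gksSum_last C v C' hC' hC'l K' k a hk ha F, h1, Real.tanh_eq_sinh_div_cosh,
    mul_div_mul_comm, mul_div_mul_left _ _ (two_ne_zero)]

include hk in
/-- Two old sites: the total coupling on `{p', q'}` in the pendant system is the old total coupling
on `{p, q}` (the pendant bond contains the last site). [folklore] -/
theorem spPend_sum_cc (p q : Fin n) :
    ∑ i ∈ Finset.univ.filter (fun i => C' i = {p.castSucc, q.castSucc}), K' i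
      = ∑ i ∈ Finset.univ.filter (fun i => C i = {p, q}), k i := by
  rw [Finset.sum_filter, Finset.sum_filter, Fin.sum_univ_castSucc]
  have hl : ¬ C' (Fin.last m) = {p.castSucc, q.castSucc} := by
    intro h
    have hmem : Fin.last n ∈ C' (Fin.last m) := by
      rw [hC'l]
      simp
    rw [h, ← spPend_map_pair] at hmem
    exact spPend_last_not_mem_map _ hmem
  rw [if_neg hl, add_zero]
  refine Finset.sum_congr rfl fun j _ => ?_
  have hiff : C' j.castSucc = {p.castSucc, q.castSucc} ↔ C j = {p, q} := by
    rw [hC', ← spPend_map_pair, Finset.map_inj]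
  by_cases h : C j = {p, q}
  · rw [if_pos (hiff.2 h), if_pos h, hk]
  · rw [if_neg (mt hiff.1 h), if_neg h]

/-- The total coupling on the pendant pair `{v', L}` is `K' (last m)`. [folklore] -/
theorem spPend_sum_vL :
    ∑ i ∈ Finset.univ.filter (fun i => C' i = {v.castSucc, Fin.last n}), K' i
      = K' (Fin.last m) := by
  rw [Finset.sum_filter, Fin.sum_univ_castSucc, if_pos hC'l, Finset.sum_eq_zero, zero_add]
  intro j _
  refine if_neg fun h => ?_
  have hmem : Fin.last n ∈ C' j.castSucc := by
    rw [h]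
    simp
  rw [hC'] at hmem
  exact spPend_last_not_mem_map _ hmem

/-- No bond of the pendant system equals `{p', L}` for an old site `p ≠ v`. [folklore] -/
theorem spPend_sum_pL (p : Fin n) (hpv : p ≠ v) :
    ∑ i ∈ Finset.univ.filter (fun i => C' i = {p.castSucc, Fin.last n}), K' i = 0 := by
  refine Finset.sum_eq_zero fun i hi => ?_
  exfalso
  rw [Finset.mem_filter] at hi
  obtain ⟨j, rfl⟩ | rfl := Fin.eq_castSucc_or_eq_last i
  · have hmem : Fin.last n ∈ C' j.castSucc := by
      rw [hi.2]
      simp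
    rw [hC'] at hmem
    exact spPend_last_not_mem_map _ hmem
  · have h := hi.2
    rw [hC'l] at h
    have hv : v.castSucc ∈ ({p.castSucc, Fin.last n} : Finset (Fin (n + 1))) := by
      rw [← h]
      simp
    simp only [Finset.mem_insert, Finset.mem_singleton, Fin.castSucc_inj] at hv
    rcases hv with hv | hv
    · exact hpv hv.symm
    · exact (Fin.castSucc_lt_last v).ne hv

end Pendant

/-! ## The registered stub -/

/-- Registered stub `helper_sp_pendant` (T-SP·1 of line `Sketch`): **the dressed edge bound DB♯
survives appending a pendant site.**  If the structure `(n, m, C)` satisfies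
`(Σ⁻¹)_xy ≤ −t/(1 + t² − 2tG_xy)` (`t = tanh` of the total coupling on `{x,y}`, `G_xy = ⟨σ_xσ_y⟩`)
for all nonnegative couplings, so does the structure with the extra site `Fin.last n` and the extra
bond `Fin.last m = {v.castSucc, Fin.last n}`.  Summing out the pendant spin identifies the old
block of `Σ'` with the old `Σ` at the couplings `K' ∘ castSucc` and the last row with
`tanh(K' last) Σ(v, ·)` (`spPend_gksExpect`, `spPend_gksExpect_last`); the bordered inverse is
explicit (`spPend_inv_entries`): old entries are those of `Σ⁻¹` (hypothesis), the pendant pair's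
entry `−t/(1−t²)` is the bound with equality, the other new entries vanish. [folklore] -/
theorem helper_sp_pendant :
    ∀ (n m : ℕ) (C : Fin m → Finset (Fin n)), (∀ i, (C i).card = 2) →
    (∀ (K : Fin m → ℝ), (∀ i, 0 ≤ K i) → ∀ x y : Fin n, x ≠ y →
        (Matrix.of fun p q : Fin n => gksExpect Finset.univ K C (fun ω => spinAt p ω * spinAt q ω))⁻¹ x y ≤
          -(Real.tanh (∑ i ∈ Finset.univ.filter (fun i => C i = {x, y}), K i)) /
            (1 + Real.tanh (∑ i ∈ Finset.univ.filter (fun i => C i = {x, y}), K i) ^ 2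
              - 2 * Real.tanh (∑ i ∈ Finset.univ.filter (fun i => C i = {x, y}), K i)
                * gksExpect Finset.univ K C (fun ω => spinAt x ω * spinAt y ω))) →
    ∀ (v : Fin n) (C' : Fin (m + 1) → Finset (Fin (n + 1))),
      (∀ i : Fin m, C' i.castSucc = (C i).map Fin.castSuccEmb) →
      C' (Fin.last m) = {v.castSucc, Fin.last n} →
      ∀ (K' : Fin (m + 1) → ℝ), (∀ i, 0 ≤ K' i) → ∀ x y : Fin (n + 1), x ≠ y →
        (Matrix.of fun p q : Fin (n + 1) => gksExpect Finset.univ K' C' (fun ω => spinAt p ω * spinAt q ω))⁻¹ x y ≤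
          -(Real.tanh (∑ i ∈ Finset.univ.filter (fun i => C' i = {x, y}), K' i)) /
            (1 + Real.tanh (∑ i ∈ Finset.univ.filter (fun i => C' i = {x, y}), K' i) ^ 2
              - 2 * Real.tanh (∑ i ∈ Finset.univ.filter (fun i => C' i = {x, y}), K' i)
                * gksExpect Finset.univ K' C' (fun ω => spinAt x ω * spinAt y ω)) := by
  intro n m C _hC hyp v C' hC' hC'l K' hK' x y hxy
  obtain ⟨k, hk⟩ : ∃ k : Fin m → ℝ, ∀ i : Fin m, K' i.castSucc = k i := ⟨_, fun _ => rfl⟩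
  obtain ⟨a, ha⟩ : ∃ a : ℝ, K' (Fin.last m) = a := ⟨_, rfl⟩
  have hk0 : ∀ i, 0 ≤ k i := fun i => hk i ▸ hK' _
  set S' : Matrix (Fin (n + 1)) (Fin (n + 1)) ℝ := Matrix.of (fun p q : Fin (n + 1) =>
    gksExpect Finset.univ K' C' (fun ω => spinAt p ω * spinAt q ω)) with hS'
  set S : Matrix (Fin n) (Fin n) ℝ := Matrix.of (fun p q : Fin n =>
    gksExpect Finset.univ k C (fun ω => spinAt p ω * spinAt q ω)) with hS
  have hGcc : ∀ p q : Fin n,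
      gksExpect Finset.univ K' C' (fun ω => spinAt p.castSucc ω * spinAt q.castSucc ω)
        = gksExpect Finset.univ k C (fun ω => spinAt p ω * spinAt q ω) := fun p q =>
    spPend_gksExpect C v C' hC' hC'l K' k a hk ha (fun ω => spinAt p ω * spinAt q ω)
  have hGLc : ∀ q : Fin n,
      gksExpect Finset.univ K' C' (fun ω => spinAt (Fin.last n) ω * spinAt q.castSucc ω)
        = Real.tanh a * gksExpect Finset.univ k C (fun ω => spinAt v ω * spinAt q ω) := fun q =>
    spPend_gksExpect_last C v C' hC' hC'l K' k a hk ha (fun ω => spinAt q ω)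
  have hGcL : ∀ p : Fin n,
      gksExpect Finset.univ K' C' (fun ω => spinAt p.castSucc ω * spinAt (Fin.last n) ω)
        = Real.tanh a * gksExpect Finset.univ k C (fun ω => spinAt p ω * spinAt v ω) := fun p =>
    (congrArg (gksExpect Finset.univ K' C') (funext fun ω => mul_comm _ _)).trans
      ((hGLc p).trans (congrArg _ (congrArg _ (funext fun ω => mul_comm _ _))))
  have hGvv : gksExpect Finset.univ k C (fun ω => spinAt v ω * spinAt v ω) = 1 :=
    gksExpect_pair_self n m k C v
  have ht : 1 - Real.tanh a ^ 2 ≠ 0 := (sub_pos.2 (Real.tanh_sq_lt_one a)).ne'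
  obtain ⟨hIcc, hIcL, hILc⟩ := spPend_inv_entries S (c5_posDef Finset.univ k C) v
    (by rw [hS, Matrix.of_apply]; exact hGvv) (Real.tanh a) ht S'
    (fun p q => by rw [hS', hS, Matrix.of_apply, Matrix.of_apply]; exact hGcc p q)
    (fun q => by rw [hS', hS, Matrix.of_apply, Matrix.of_apply]; exact hGLc q)
    (fun p => by rw [hS', hS, Matrix.of_apply, Matrix.of_apply]; exact hGcL p)
    (by rw [hS', Matrix.of_apply]; exact gksExpect_pair_self (n + 1) (m + 1) K' C' (Fin.last n))
  obtain ⟨p, rfl⟩ | rfl := Fin.eq_castSucc_or_eq_last x <;>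
    obtain ⟨q, rfl⟩ | rfl := Fin.eq_castSucc_or_eq_last y
  · -- two old sites: the hypothesis at the couplings `k`
    have hpq : p ≠ q := fun h => hxy (by rw [h])
    rw [hIcc p q, if_neg (fun h => hpq (h.1.trans h.2.symm)), add_zero,
      spPend_sum_cc C v C' hC' hC'l K' k hk p q, hGcc p q]
    exact hyp k hk0 p q hpq
  · -- `(p', L)`
    rw [hIcL p]
    by_cases hpv : p = v
    · subst hpv
      rw [if_pos rfl, spPend_sum_vL C p C' hC' hC'l K', ha, hGcL p, hGvv, mul_one,
        show (1 : ℝ) + Real.tanh a ^ 2 - 2 * Real.tanh a * Real.tanh a = 1 - Real.tanh a ^ 2 by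
          ring]
    · rw [if_neg hpv, spPend_sum_pL C v C' hC' hC'l K' p hpv, Real.tanh_zero]
      simp
  · -- `(L, q')`
    rw [hILc q, Finset.pair_comm (Fin.last n) q.castSucc]
    by_cases hqv : q = v
    · subst hqv
      rw [if_pos rfl, spPend_sum_vL C q C' hC' hC'l K', ha, hGLc q, hGvv, mul_one,
        show (1 : ℝ) + Real.tanh a ^ 2 - 2 * Real.tanh a * Real.tanh a = 1 - Real.tanh a ^ 2 by
          ring]
    · rw [if_neg hqv, spPend_sum_pL C v C' hC' hC'l K' q hqv, Real.tanh_zero]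
      simp
  · exact absurd rfl hxy

end Summit.CriticalPhenomena.Ising3DConformalLimit.Cruxes.InverseMFerromagnet.PartialCovarianceLadder
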